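import Literature.Topology.FourManifolds.PlanarSurfaceTwist
import Literature.Topology.FourManifolds.DehnNielsenBaerFlowerSymmetries
import Mathlib.Analysis.SpecialFunctions.Trigonometric.InverseDeriv
import HarnessLib

/-!
# Dehn–Nielsen–Baer on the flower surface: the Dehn twists about the hole circles of `∂V_g`

Topic `Literature/Topology/FourManifolds`; fifth PROOF file of the named fact
`Literature.Topology.FourManifolds.DehnNielsenBaerSurfaceSmooth` (`DehnNielsenBaerSurface.lean`),
after `DehnNielsenBaerSurfaceProofs.lean`, `DehnNielsenBaerTorus.lean`,
`DehnNielsenBaerGenerators.lean` and `DehnNielsenBaerFlowerSymmetries.lean` (it remains to realise, by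
based diffeomorphisms of the flower surface `∂V_g`, `g ≥ 2`, a set of automorphisms of
`π₁(∂V_g, x₀)` generating `Aut π₁` together with `Inn π₁`, the rotations and the reflection).  Here
the first non-symmetry generators are realised: **the Dehn twists of `∂V_g` about the hole circles of
the upper sheet** — the level circles `{q_g = c_g - h₀²} × {h₀}` around the first hole of the
flower domain `{q_g ≤ c_g}` (those around the other holes are their conjugates by the rotations) —,
as based diffeomorphisms of `(∂V_g, x₀)` (`PlanarSurfaceTwist.exists_surfaceDehnTwist` for
`q = q_g`), hence outer-realising the automorphisms of `π₁(∂V_g, x₀)` they induce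
(`exists_diffeomorph_path_map_eq_fundamentalGroupCongr`).

* `FlowerModel.isCompact_flower_preimage_Iic` — the flower `q_g` has compact sublevel sets;
* `FlowerModel.fderiv_flower_ne_zero` — no critical VALUE of `q_g` lies in
  `(q_g(r_b), q_g(r_a))` (the critical values are `0`, `q_g(r_a)` — the peaks — and `q_g(r_b)` — the
  passes, `isMCriticalPt_iff_eq`);
* `FlowerModel.exists_clamp` — a smooth clamp `κ = id` on `[s₀ - Δ, s₀ + Δ]` with values in
  `(s₀ - 2Δ, s₀ + 2Δ)`;
* `FlowerModel.exists_levelTransversal` — **a smooth transversal to the hole circles parametrised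
  by the level**: `γ(s) = r₇ e^{i arccos((κ s - r₇²)/V(r₇))/g}` on the circle of radius
  `r₇ = 7^{1/20g}` (where `q_g(r e^{iθ}) = r² + V(r) cos gθ`, `FlowerDomainPolar.flower_pol`),
  `q_g(γ s) = s` on the band;
* `FlowerModel.exists_holeDehnTwist` — **the Dehn twists about the hole circle at height `h₀`**:
  for `0 < h₀` with `c_g - h₀²` above `max(q_g(r_b), r₇² - V(r₇))`, the cut-off `ψ` and the flow
  `θ` of `PlanarLevelTwist.exists_planarLevelPackage` for `q_g`, one positive period, and for every positive period `T₀` and every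
  `ε₀ > 0` a width `ε ≤ ε₀`, the period function, the twist profile `λ`, and a diffeomorphism `T` of
  `∂V_g` FIXING THE BASE POINT `x₀` (the upper pole, of height `√c_g > h₀`), given over the family of
  circles by `x ↦ θ(λ(z), x)` and equal to the identity off it and at heights outside
  `[h₀ - ε, h₀]`;
* `FlowerModel.realised_of_apply_northPole` — every based diffeomorphism of `(∂V_g, x₀)`
  outer-realises its automorphism of `π₁` and the inverse (the hypothesis shape of
  `dehnNielsenBaerSurfaceSmooth_of_flower_generators_symm`).

Everything is proved; no new definitions (D-0026).

## References

* B. Farb, D. Margalit, *A primer on mapping class groups*, PMS 49 (2012), §3.1.1 (Dehn twists),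
  Thm. 4.1 and §4.4 (Dehn–Lickorish–Humphries generators), Thm. 8.1 (Dehn–Nielsen–Baer).
  [FarbMargalit2012]
* H. Zieschang, E. Vogt, H.-D. Coldewey, *Surfaces and planar discontinuous groups*, LNM 835 (1980),
  Thm. 5.6.1–5.6.2. [ZieschangVogtColdewey1980]
-/

open scoped Manifold ContDiff Topology Real
open Set Function Filter Metric

noncomputable section

namespace Literature.Topology.FourManifolds

open PlanarThickening Literature.Geometry.Manifold Literature.AlgebraicTopology.FundamentalGroup
  PlanarLevelTwist

/-- Local notation: `𝔼 n` is the model Euclidean space `EuclideanSpace ℝ (Fin n)`. -/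
local notation "𝔼 " n:arg => EuclideanSpace ℝ (Fin n)

namespace FlowerModel

variable {g : ℕ}

/-! ### §1 Coercivity and the regular band of the flower -/

/-- **The flower has compact sublevel sets** (`‖p‖² ≤ q_g(p) + 20`). [folklore] -/
theorem isCompact_flower_preimage_Iic (hg : 1 ≤ g) (s : ℝ) : IsCompact (flower g ⁻¹' Iic s) := by
  refine (isCompact_closedBall (0 : 𝔼 2) (Real.sqrt (s + 20))).of_isClosed_subset
    (isClosed_Iic.preimage contDiff_flower.continuous) fun p hp => ?_
  rw [mem_closedBall, dist_zero_right]
  have h1 := norm_sq_le_flower_add hg p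
  have h2 : flower g p ≤ s := hp
  exact (le_abs_self _).trans (Real.abs_le_sqrt (by linarith))

/-- The axis profile is positive away from the origin. [folklore] -/
theorem prof_pos_of_pos {r : ℝ} (hr : 0 < r) : 0 < prof g r := by
  rw [prof_eq]
  have h1 := V_nonneg (g := g) hr.le
  have h2 : 0 < r ^ 2 := by positivity
  linarith

/-- **No critical value of the flower lies strictly between the pass value `q_g(r_b)` and the peak
value `q_g(r_a)`**: the critical points are the origin (value `0 < q_g(r_b)`), the peaks `r_a ζ_j`
and the passes `r_b ζ_j` (`isMCriticalPt_iff_eq`). [folklore] -/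
theorem fderiv_flower_ne_zero (hg : 2 ≤ g) {p : 𝔼 2}
    (hp : flower g p ∈ Ioo (prof g (rb hg)) (prof g (ra hg))) : fderiv ℝ (flower g) p ≠ 0 := by
  intro hd
  have hg1 : 1 ≤ g := by omega
  have hc : IsMCriticalPt (𝓡 2) (flower g) p := by
    rw [isMCriticalPt_iff, ← fderiv_flower]; exact hd
  rcases (isMCriticalPt_iff_eq hg p).1 hc with rfl | ⟨j, -, rfl | rfl⟩
  · rw [flower_zero hg1] at hp
    exact absurd hp.1 (not_lt.2 (prof_pos_of_pos (rb_pos hg)).le)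
  · rw [flower_rot (ζC_pow hg1 j), flower_ax'] at hp
    exact lt_irrefl _ hp.2
  · rw [flower_rot (ζC_pow hg1 j), flower_ax'] at hp
    exact lt_irrefl _ hp.1

/-! ### §2 The transversal to the hole circles, parametrised by the level -/

/-- **A smooth clamp**: `κ = id` on `[s₀ - Δ, s₀ + Δ]`, with all its values in
`(s₀ - 2Δ, s₀ + 2Δ)` (`κ s = s₀ + φ(s) (s - s₀)` for a plateau `φ`). [folklore] -/
theorem exists_clamp (s₀ : ℝ) {Δ : ℝ} (hΔ : 0 < Δ) :
    ∃ κ : ℝ → ℝ, ContDiff ℝ ∞ κ ∧ (∀ s ∈ Icc (s₀ - Δ) (s₀ + Δ), κ s = s) ∧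
      ∀ s, κ s ∈ Ioo (s₀ - 2 * Δ) (s₀ + 2 * Δ) := by
  obtain ⟨φ, hφs, hφ01, hφ1, hφsupp⟩ := exists_plateau (a := s₀) (b := s₀) hΔ
  refine ⟨fun s => s₀ + φ s * (s - s₀), ?_, fun s hs => ?_, fun s => ?_⟩
  · exact contDiff_const.add (hφs.mul (contDiff_id.sub contDiff_const))
  · show s₀ + φ s * (s - s₀) = s
    rw [hφ1 s hs]; ring
  · show s₀ + φ s * (s - s₀) ∈ Ioo (s₀ - 2 * Δ) (s₀ + 2 * Δ)
    by_cases h : φ s = 0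
    · rw [h, zero_mul, add_zero]; exact ⟨by linarith, by linarith⟩
    · have hs := hφsupp s h
      have h01 := hφ01 s
      have hφpos : 0 < φ s := lt_of_le_of_ne h01.1 (Ne.symm h)
      constructor
      · nlinarith [mul_pos hφpos (sub_pos.2 hs.1), mul_nonneg (sub_nonneg.2 h01.2) hΔ.le]
      · nlinarith [mul_pos hφpos (sub_pos.2 hs.2), mul_nonneg (sub_nonneg.2 h01.2) hΔ.le]

/-- The circle of radius `r` is a smooth curve `θ ↦ r e^{iθ}`. [folklore] -/
theorem contDiff_pol_right (r : ℝ) : ContDiff ℝ ∞ fun t : ℝ => pol r t := by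
  have : (fun t : ℝ => pol r t) =
      fun t : ℝ => toC.symm ((r : ℂ) * Complex.exp ((↑t : ℂ) * Complex.I)) := rfl
  rw [this]
  exact toC.symm.toContinuousLinearEquiv.contDiff.comp (contDiff_const.mul
    (Complex.contDiff_exp.comp (Complex.ofRealCLM.contDiff.mul contDiff_const)))

/-- **A smooth transversal to the hole circles parametrised by the level.**  For a band
`[s₀ - Δ, s₀ + Δ]` with `(s₀ - 2Δ, s₀ + 2Δ) ⊆ (r₇² - V(r₇), c_g)`, `r₇ = 7^{1/20g}` (recall
`c_g = q_g(r₇, 0) = r₇² + V(r₇)`): the curve `γ(s) = r₇ e^{iα(s)}`, `α(s) = arccos((κ s - r₇²)/V(r₇))/g`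
on the circle of radius `r₇`, is smooth on `ℝ` and satisfies `q_g(γ s) = s` on the band
(`q_g(r e^{iθ}) = r² + V(r) cos gθ`). [folklore] -/
theorem exists_levelTransversal (hg : 2 ≤ g) {s₀ Δ : ℝ} (hΔ : 0 < Δ)
    (hlo : vprof g (rt g 7) ≤ s₀ - 2 * Δ) (hhi : s₀ + 2 * Δ ≤ level g) :
    ∃ γ : ℝ → 𝔼 2, ContDiff ℝ ∞ γ ∧ (∀ s ∈ Icc (s₀ - Δ) (s₀ + Δ), flower g (γ s) = s) ∧
      ∀ s ∈ Icc (s₀ - Δ) (s₀ + Δ),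
        γ s = pol (rt g 7) (Real.arccos ((s - rt g 7 ^ 2) / V g (rt g 7)) / g) := by
  have hg1 : 1 ≤ g := by omega
  have hgpos : (0 : ℝ) < g := by exact_mod_cast (show 0 < g by omega)
  set r₇ : ℝ := rt g 7 with hr₇
  have hr₇pos : 0 < r₇ := rt_pos (by norm_num)
  have hV : 0 < V g r₇ := V_pos hg1 hr₇pos
  have hlevel : level g = r₇ ^ 2 + V g r₇ := by
    show prof g (rt g 7) = _
    rw [prof_eq]
  have hvprof : vprof g r₇ = r₇ ^ 2 - V g r₇ := rfl
  obtain ⟨κ, hκs, hκid, hκmem⟩ := exists_clamp s₀ hΔ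
  set u : ℝ → ℝ := fun s => (κ s - r₇ ^ 2) / V g r₇ with hudef
  have hus : ContDiff ℝ ∞ u := (hκs.sub contDiff_const).div_const _
  have hu1 : ∀ s, u s ∈ Ioo (-1 : ℝ) 1 := by
    intro s
    have h := hκmem s
    constructor
    · rw [hudef]
      rw [lt_div_iff₀ hV]
      have : vprof g r₇ < κ s := lt_of_le_of_lt hlo h.1
      rw [hvprof] at this
      linarith
    · rw [hudef, div_lt_one hV]
      have : κ s < level g := lt_of_lt_of_le h.2 hhi
      rw [hlevel] at this
      linarith
  have harccos : ContDiff ℝ ∞ fun s => Real.arccos (u s) :=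
    contDiff_iff_contDiffAt.2 fun s =>
      (Real.contDiffAt_arccos (ne_of_gt (hu1 s).1) (ne_of_lt (hu1 s).2)).comp s hus.contDiffAt
  refine ⟨fun s => pol r₇ (Real.arccos (u s) / g), (contDiff_pol_right r₇).comp (harccos.div_const _),
    fun s hs => ?_, fun s hs => ?_⟩
  · show flower g (pol r₇ (Real.arccos (u s) / g)) = s
    rw [flower_pol, mul_div_cancel₀ _ hgpos.ne', Real.cos_arccos (hu1 s).1.le (hu1 s).2.le, hudef]
    simp only
    rw [mul_div_cancel₀ _ hV.ne', hκid s hs]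
    ring
  · show pol r₇ (Real.arccos (u s) / g) = _
    simp only [hudef]
    rw [hκid s hs]

/-! ### §3 The Dehn twists about the hole circles of the upper sheet -/

/-- **The Dehn twists of `∂V_g` about the hole circle `{q_g = c_g - h₀²} × {h₀}`** (the component
through `γ(c_g - h₀²)`, around the first hole), as diffeomorphisms of `∂V_g` fixing the base point.
For `0 < h₀` with `c_g - h₀² > max(q_g(r_b), r₇² - V(r₇))`: a half-width `Δ > 0` of a regular band,
the transversal `γ` (`q_g ∘ γ = id` on the band), the cut-off `ψ` and the flow `θ` of `ℝ³` of
`PlanarLevelTwist.exists_planarLevelPackage` for `q_g` (smooth, complete, velocity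
`twistField bE3 bF2 (levelPair q_g) ψ` with `ψ = 1` on the `Δ/2`-box and `= 0` off the `Δ`-box,
preserving `(q_g ∘ π, z)`, fixing `{ψ = 0}`), one positive period of the circle through `σ₀ = (γ(c_g - h₀²), h₀)`, and for every positive
period `T₀` of it and every `ε₀ > 0`: the smooth positive period function `P` on an open `S`
(`P(c_g - h₀², h₀) = T₀`), a width `0 < ε ≤ ε₀`, the twist profile `λ` (`= 0` below `h₀ - ε`, `=` the
period on `[h₀, h₀ + 2ε]`) and a diffeomorphism `T` of `∂V_g` with `T x₀ = x₀`, equal to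
`x ↦ θ(λ(z), x)` on the boundary points of the family of circles below height `h₀ + 2ε` and to the
identity at those off the family or of height outside `[h₀ - ε, h₀]`.
[cite: FarbMargalit2012, §3.1.1 and Thm. 4.1] -/
theorem exists_holeDehnTwist (hg : 2 ≤ g) {h₀ : ℝ} (hh₀ : 0 < h₀)
    (hband : max (prof g (rb hg)) (vprof g (rt g 7)) < level g - h₀ ^ 2) :
    ∃ (Δ : ℝ) (γ : ℝ → 𝔼 2) (ψ : 𝔼 3 → ℝ) (θ : ℝ × 𝔼 3 → 𝔼 3), 0 < Δ ∧ ContDiff ℝ ∞ γ ∧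
      (∀ s ∈ Icc (level g - h₀ ^ 2 - Δ) (level g - h₀ ^ 2 + Δ), flower g (γ s) = s) ∧
      (∀ s ∈ Icc (level g - h₀ ^ 2 - Δ) (level g - h₀ ^ 2 + Δ),
        γ s = pol (rt g 7) (Real.arccos ((s - rt g 7 ^ 2) / V g (rt g 7)) / g)) ∧
      ContDiff ℝ ∞ ψ ∧
      (∀ x, levelPair (flower g) x ∈ Ioo (level g - h₀ ^ 2 - Δ / 2) (level g - h₀ ^ 2 + Δ / 2) ×ˢ
          Ioo (h₀ - Δ / 2) (h₀ + Δ / 2) → ψ x = 1) ∧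
      (∀ x, (flower g (proj x) ∉ Ioo (level g - h₀ ^ 2 - Δ) (level g - h₀ ^ 2 + Δ) ∨
          x 2 ∉ Ioo (h₀ - Δ) (h₀ + Δ)) → ψ x = 0) ∧
      ContDiff ℝ ∞ θ ∧ (∀ x, θ (0, x) = x) ∧ (∀ t s x, θ (t, θ (s, x)) = θ (t + s, x)) ∧
      (∀ x t, HasDerivAt (fun t => θ (t, x))
        (twistField bE3 bF2 (levelPair (flower g)) ψ (θ (t, x))) t) ∧
      (∀ t x, levelPair (flower g) (θ (t, x)) = levelPair (flower g) x) ∧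
      (∀ x, ψ x = 0 → ∀ t, θ (t, x) = x) ∧
      (∃ T₀ : ℝ, 0 < T₀ ∧
        θ (T₀, lift (γ (level g - h₀ ^ 2)) + h₀ • ez) = lift (γ (level g - h₀ ^ 2)) + h₀ • ez) ∧
      ∀ T₀ : ℝ, 0 < T₀ →
        θ (T₀, lift (γ (level g - h₀ ^ 2)) + h₀ • ez) = lift (γ (level g - h₀ ^ 2)) + h₀ • ez →
        ∀ ε₀ : ℝ, 0 < ε₀ →
        ∃ (P : ℝ × ℝ → ℝ) (S : Set (ℝ × ℝ)) (ε : ℝ) (lam : ℝ → ℝ)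
          (T : (𝓡∂ 3).boundary (FlowerHandlebody hg) ≃ₘ⟮𝓡 2, 𝓡 2⟯
            (𝓡∂ 3).boundary (FlowerHandlebody hg)),
          IsOpen S ∧ (level g - h₀ ^ 2, h₀) ∈ S ∧ ContDiffOn ℝ ∞ P S ∧
          P (level g - h₀ ^ 2, h₀) = T₀ ∧ (∀ s ∈ S, 0 < P s) ∧
          (∀ s ∈ S, θ (P s, lift (γ s.1) + s.2 • ez) = lift (γ s.1) + s.2 • ez) ∧
          IsOpen (flowSaturation θ (fun s : ℝ × ℝ => lift (γ s.1) + s.2 • ez) S) ∧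
          0 < ε ∧ ε ≤ ε₀ ∧ (∀ h ∈ Icc (h₀ - 3 * ε) (h₀ + 3 * ε), (level g - h ^ 2, h) ∈ S) ∧
          ContDiff ℝ ∞ lam ∧ (∀ h, h ≤ h₀ - ε → lam h = 0) ∧
          (∀ h ∈ Icc h₀ (h₀ + 2 * ε), lam h = P (level g - h ^ 2, h)) ∧
          T (northPole hg) = northPole hg ∧
          (∀ z, boundaryIncl hg z ∈ flowSaturation θ (fun s : ℝ × ℝ => lift (γ s.1) + s.2 • ez) S →
            boundaryIncl hg z 2 < h₀ + 2 * ε →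
            boundaryIncl hg (T z) = θ (lam (boundaryIncl hg z 2), boundaryIncl hg z)) ∧
          ∀ z, (boundaryIncl hg z ∉ flowSaturation θ (fun s : ℝ × ℝ => lift (γ s.1) + s.2 • ez) S ∨
            boundaryIncl hg z 2 ∉ Icc (h₀ - ε) h₀) → T z = z := by
  have hg1 : 1 ≤ g := by omega
  set c := level g with hcdef
  set s₀ := c - h₀ ^ 2 with hs₀def
  set lo := max (prof g (rb hg)) (vprof g (rt g 7)) with hlodef
  have hs₀c : s₀ < c := by
    have : 0 < h₀ ^ 2 := by positivity
    linarith
  set Δ := min (s₀ - lo) (c - s₀) / 3 with hΔdef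
  have hΔ : 0 < Δ := by
    have : 0 < min (s₀ - lo) (c - s₀) := lt_min (by linarith) (by linarith)
    linarith
  have hΔlo : lo < s₀ - 2 * Δ := by
    have := min_le_left (s₀ - lo) (c - s₀); linarith
  have hΔhi : s₀ + 2 * Δ < c := by
    have := min_le_right (s₀ - lo) (c - s₀); linarith
  -- the transversal
  obtain ⟨γ, hγs, hqγ, hγeq⟩ := exists_levelTransversal hg hΔ
    ((le_max_right _ _).trans hΔlo.le) hΔhi.le
  -- the regular band
  have hδ : 0 < Δ / 2 := by linarith
  have hreg : ∀ p, flower g p ∈ Ioo (s₀ - 2 * (Δ / 2)) (s₀ + 2 * (Δ / 2)) →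
      fderiv ℝ (flower g) p ≠ 0 := by
    intro p hp
    refine fderiv_flower_ne_zero hg ⟨?_, ?_⟩
    · exact lt_of_le_of_lt (le_max_left _ _) (by linarith [hp.1])
    · linarith [hp.2, level_lt_prof_ra hg]
  have hqγ' : ∀ s ∈ Ioo (s₀ - 2 * (Δ / 2)) (s₀ + 2 * (Δ / 2)), flower g (γ s) = s :=
    fun s hs => hqγ s ⟨by linarith [hs.1], by linarith [hs.2]⟩
  -- the generic surface Dehn twist
  obtain ⟨ψ, θ, hψs, hψ1, hψzero, hθ, h0, hadd, hint, hHinv, hfix, hper, htwist⟩ :=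
    exists_surfaceDehnTwist contDiff_flower (isCompact_flower_preimage_Iic hg1)
      (isHoledDiscMorseFunction_flower hg).isRegularLevel hδ hreg hγs hqγ'
      (h₀ := h₀) (s₁ := s₀) (s₂ := s₀) (h₁ := h₀) (h₂ := h₀) ⟨le_rfl, le_rfl⟩ ⟨le_rfl, le_rfl⟩
  have hI : Ioo (s₀ - 2 * (Δ / 2)) (s₀ + 2 * (Δ / 2)) =
      Ioo (level g - h₀ ^ 2 - Δ) (level g - h₀ ^ 2 + Δ) := by
    rw [hs₀def, hcdef]; congr 1 <;> ring
  have hI' : Ioo (h₀ - 2 * (Δ / 2)) (h₀ + 2 * (Δ / 2)) = Ioo (h₀ - Δ) (h₀ + Δ) := by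
    congr 1 <;> ring
  rw [hI, hI'] at hψzero
  refine ⟨Δ, γ, ψ, θ, hΔ, hγs, hqγ, hγeq, hψs, fun x hx => hψ1 x ?_, hψzero, hθ, h0, hadd, hint,
    hHinv, hfix, hper, fun T₀ hT₀ hT ε₀ hε₀ => ?_⟩
  · have hJ : Ioo (s₀ - Δ / 2) (s₀ + Δ / 2) =
        Ioo (level g - h₀ ^ 2 - Δ / 2) (level g - h₀ ^ 2 + Δ / 2) := by rw [hs₀def, hcdef]
    rw [hJ]
    exact hx
  obtain ⟨P, S, ε, lam, T, hSo, hs₀S, -, hPs, hP0, hPpos, hPS, hopen, hε, hεε₀, hparS, hlams,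
    hlam0, hlam1, hTon, hToff⟩ := htwist T₀ hT₀ hT ε₀ hε₀
  refine ⟨P, S, ε, lam, T, hSo, hs₀S, hPs, hP0, hPpos, hPS, hopen, hε, hεε₀, hparS, hlams, hlam0,
    hlam1, ?_, hTon, hToff⟩
  -- the base point (height `√c > h₀`) is fixed
  refine hToff _ (Or.inr fun hmem => ?_)
  change boundaryIncl hg (northPole hg) 2 ∈ Icc (h₀ - ε) h₀ at hmem
  have htop : boundaryIncl hg (northPole hg) 2 = Real.sqrt c := by
    rw [boundaryIncl_northPole]; simp [top, hcdef]
  rw [htop] at hmem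
  have h1 : h₀ ^ 2 < c := by
    have := prof_pos_of_pos (g := g) (rb_pos hg)
    have := le_max_left (prof g (rb hg)) (vprof g (rt g 7))
    linarith
  have h2 : h₀ < Real.sqrt c := Real.lt_sqrt_of_sq_lt h1
  exact absurd hmem.2 (not_le.2 h2)

/-! ### §4 Based diffeomorphisms of `(∂V_g, x₀)` are realised -/

/-- **Every diffeomorphism of `∂V_g` fixing the base point outer-realises the automorphism of
`π₁(∂V_g, x₀)` it induces, and its inverse** — in particular the Dehn twists of
`exists_holeDehnTwist` —, in the hypothesis shape of
`dehnNielsenBaerSurfaceSmooth_of_flower_generators_symm`. [cite: FarbMargalit2012, Thm. 8.1] -/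
theorem realised_of_apply_northPole (hg : 2 ≤ g)
    (T : (𝓡∂ 3).boundary (FlowerHandlebody hg) ≃ₘ⟮𝓡 2, 𝓡 2⟯ (𝓡∂ 3).boundary (FlowerHandlebody hg))
    (hT : T (northPole hg) = northPole hg) :
    (∃ (f : (𝓡∂ 3).boundary (FlowerHandlebody hg) ≃ₘ⟮𝓡 2, 𝓡 2⟯ (𝓡∂ 3).boundary (FlowerHandlebody hg))
        (p : Path (northPole hg) (f (northPole hg))), ∀ γ,
      FundamentalGroup.map (⟨f, f.continuous⟩ : C(_, _)) (northPole hg) γ =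
        FundamentalGroup.fundamentalGroupMulEquivOfPath p
          (Homeomorph.fundamentalGroupCongr T.toHomeomorph hT γ)) ∧
    (∃ (f : (𝓡∂ 3).boundary (FlowerHandlebody hg) ≃ₘ⟮𝓡 2, 𝓡 2⟯ (𝓡∂ 3).boundary (FlowerHandlebody hg))
        (p : Path (northPole hg) (f (northPole hg))), ∀ γ,
      FundamentalGroup.map (⟨f, f.continuous⟩ : C(_, _)) (northPole hg) γ =
        FundamentalGroup.fundamentalGroupMulEquivOfPath p
          ((Homeomorph.fundamentalGroupCongr T.toHomeomorph hT)⁻¹ γ)) :=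
  exists_diffeomorph_path_map_eq_fundamentalGroupCongr T hT

end FlowerModel

end Literature.Topology.FourManifolds

end
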